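import Mathlib
import HarnessLib
import Literature.Uncategorized.WallMajorant

/-!
# S1 — normalised wall majorant from sublinearity

Given `ρ : ℝ → ℝ` with `ρ t / t → 0` at `+∞` (no regularity, no sign), a slope `ε > 0` and a floor
`R`, we build a continuous, non-decreasing, sublinear wall `W ≥ R` of one-sided slope `≤ ε`
(`W s' ≤ W s + ε (s' - s)` for `s ≤ s'`) with `3 ρ s + 2 ≤ W s` for all late `s`.

Main declarations: `WallMajorant` (the statement registered as stub S1 of the `NeckGapDecay`
skeleton v2, verbatim) and `stub_wallMajorant : Literature.Uncategorized.WallMajorant`.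

Construction (pure real analysis; the only definition is the statement `WallMajorant` itself):
* pick `T ≥ 1` with `ρ u ≤ u` on `[T, ∞)`; the running supremum `M s := sup_{[T, s]} max ρ 0` is
  monotone, nonnegative, dominates `ρ` on `[T, ∞)` and is still sublinear (`M s / s → 0`);
* `g := 3 M + 2 + |R|` is monotone, sublinear, `≥ R`, and `≥ 3 ρ + 2` on `[T, ∞)`;
* `W s := sup_{u ≥ 0} (g (s + u) - ε u)`, the `ε`-Lipschitz upper envelope of `g`, is monotone,
  has slope `≤ ε` (hence is continuous), dominates `g`, and is sublinear because `g` is.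
The running supremum and the envelope are handled through their defining equations `hM`, `hW`
(hypotheses), so that no auxiliary definition is introduced.
-/

open Filter Set Topology

namespace Summit.FinalStateConjecture.FinalStateConjecture.Theorems.NeckGapDecay.ConnectionLevelCones.WallMajorantStub
set_option linter.dupNamespace false

/-- Sublinearity in `ε`-form: beyond a threshold `T ≥ 1` one has `ρ u ≤ ε * u`. [folklore] -/
private lemma exists_forall_le_mul {ρ : ℝ → ℝ} (hρ : Tendsto (fun t ↦ ρ t / t) atTop (𝓝 0))
    {ε : ℝ} (hε : 0 < ε) : ∃ T : ℝ, 1 ≤ T ∧ ∀ u, T ≤ u → ρ u ≤ ε * u := by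
  obtain ⟨T, hT⟩ := eventually_atTop.1 ((hρ.eventually_le_const hε).and (eventually_ge_atTop 1))
  refine ⟨T, (hT T le_rfl).2, fun u hu ↦ ?_⟩
  obtain ⟨h1, h2⟩ := hT u hu
  exact (div_le_iff₀ (one_pos.trans_le h2)).1 h1

section RunMax

/-! ### The running supremum `M s = sSup (max ρ 0 '' [T, s])`, via its defining equation -/

variable {ρ M : ℝ → ℝ} {T : ℝ}

/-- The window image is bounded above (by `s`) once `ρ u ≤ u` beyond `T ≥ 0`. [folklore] -/
private lemma window_bddAbove (hT0 : 0 ≤ T) (hT : ∀ u, T ≤ u → ρ u ≤ u) (s : ℝ) :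
    BddAbove ((fun u ↦ max (ρ u) 0) '' Icc T s) := by
  refine ⟨s, ?_⟩
  rintro _ ⟨u, ⟨hu1, hu2⟩, rfl⟩
  exact max_le ((hT u hu1).trans hu2) (hT0.trans (hu1.trans hu2))

/-- The running supremum is nonnegative (also on empty windows, `sSup ∅ = 0`). [folklore] -/
private lemma runMax_nonneg (hM : ∀ s, M s = sSup ((fun u ↦ max (ρ u) 0) '' Icc T s)) (s : ℝ) :
    0 ≤ M s := by
  rw [hM s]
  refine Real.sSup_nonneg ?_
  rintro _ ⟨u, -, rfl⟩
  exact le_max_right _ _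

/-- The running supremum dominates `max (ρ s) 0` on `[T, ∞)`. [folklore] -/
private lemma le_runMax (hM : ∀ s, M s = sSup ((fun u ↦ max (ρ u) 0) '' Icc T s)) (hT0 : 0 ≤ T)
    (hT : ∀ u, T ≤ u → ρ u ≤ u) {s : ℝ} (hs : T ≤ s) : max (ρ s) 0 ≤ M s := by
  rw [hM s]
  exact le_csSup (window_bddAbove hT0 hT s) ⟨s, ⟨hs, le_rfl⟩, rfl⟩

/-- The running supremum is monotone. [folklore] -/
private lemma runMax_mono (hM : ∀ s, M s = sSup ((fun u ↦ max (ρ u) 0) '' Icc T s)) (hT0 : 0 ≤ T)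
    (hT : ∀ u, T ≤ u → ρ u ≤ u) : Monotone M := by
  intro a b hab
  by_cases ha : T ≤ a
  · rw [hM a, hM b]
    exact csSup_le_csSup (window_bddAbove hT0 hT b) ⟨_, T, ⟨le_rfl, ha⟩, rfl⟩
      (image_mono (Icc_subset_Icc_right hab))
  · have h0 : M a = 0 := by
      rw [hM a]
      simp [Icc_eq_empty ha]
    rw [h0]
    exact runMax_nonneg hM b

/-- Linear-growth control of the running supremum beyond an `ε`-threshold `Tε`. [folklore] -/
private lemma runMax_le_add (hM : ∀ s, M s = sSup ((fun u ↦ max (ρ u) 0) '' Icc T s))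
    (hT0 : 0 ≤ T) (hT : ∀ u, T ≤ u → ρ u ≤ u) {ε Tε : ℝ} (hε : 0 ≤ ε) (hTε0 : 0 ≤ Tε)
    (hρε : ∀ u, Tε ≤ u → ρ u ≤ ε * u) {s : ℝ} (hs : Tε ≤ s) : M s ≤ M Tε + ε * s := by
  have hεs : 0 ≤ ε * s := mul_nonneg hε (hTε0.trans hs)
  have hM0 := runMax_nonneg hM Tε
  rw [hM s]
  refine Real.sSup_le ?_ (add_nonneg hM0 hεs)
  rintro _ ⟨u, ⟨hu1, hu2⟩, rfl⟩
  change max (ρ u) 0 ≤ M Tε + ε * s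
  rcases le_or_gt u Tε with h | h
  · have h' : max (ρ u) 0 ≤ M Tε := by
      rw [hM Tε]
      exact le_csSup (window_bddAbove hT0 hT Tε) ⟨u, ⟨hu1, h⟩, rfl⟩
    linarith
  · have h1 : ρ u ≤ ε * u := hρε u h.le
    have h2 : ε * u ≤ ε * s := mul_le_mul_of_nonneg_left hu2 hε
    exact max_le (by linarith) (by linarith)

/-- The running supremum is sublinear: `M s / s → 0`. [folklore] -/
private lemma tendsto_runMax_div (hM : ∀ s, M s = sSup ((fun u ↦ max (ρ u) 0) '' Icc T s))
    (hρ : Tendsto (fun t ↦ ρ t / t) atTop (𝓝 0)) (hT0 : 0 ≤ T) (hT : ∀ u, T ≤ u → ρ u ≤ u) :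
    Tendsto (fun s ↦ M s / s) atTop (𝓝 0) := by
  rw [tendsto_order]
  refine ⟨fun a ha ↦ ?_, fun b hb ↦ ?_⟩
  · filter_upwards [eventually_gt_atTop 0] with s hs
    exact ha.trans_le (div_nonneg (runMax_nonneg hM s) hs.le)
  · obtain ⟨Tε, hTε1, hTε⟩ := exists_forall_le_mul hρ (half_pos hb)
    have hlim : Tendsto (fun s : ℝ ↦ M Tε / s) atTop (𝓝 0) :=
      tendsto_const_nhds.div_atTop tendsto_id
    filter_upwards [eventually_ge_atTop Tε, eventually_gt_atTop 0,
      hlim.eventually_lt_const (half_pos hb)] with s hs1 hs2 hs3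
    have hle : M s ≤ M Tε + b / 2 * s :=
      runMax_le_add hM hT0 hT (half_pos hb).le (zero_le_one.trans hTε1) hTε hs1
    calc M s / s ≤ (M Tε + b / 2 * s) / s := div_le_div_of_nonneg_right hle hs2.le
      _ = M Tε / s + b / 2 := by rw [add_div, mul_div_assoc, div_self hs2.ne', mul_one]
      _ < b := by linarith

/-- A sublinear profile has a monotone, nonnegative, sublinear majorant on some `[T, ∞)`
(the running supremum of `max ρ 0` over `[T, s]`, where `ρ u ≤ u` on `[T, ∞)`). [folklore] -/
private lemma exists_monotone_majorant (hρ : Tendsto (fun t ↦ ρ t / t) atTop (𝓝 0)) :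
    ∃ (T : ℝ) (M : ℝ → ℝ), Monotone M ∧ (∀ s, 0 ≤ M s) ∧ (∀ s, T ≤ s → ρ s ≤ M s) ∧
      Tendsto (fun s ↦ M s / s) atTop (𝓝 0) := by
  obtain ⟨T, hT1, hT⟩ := exists_forall_le_mul hρ one_pos
  have hT0 : 0 ≤ T := zero_le_one.trans hT1
  have hT' : ∀ u, T ≤ u → ρ u ≤ u := fun u hu ↦ (hT u hu).trans_eq (one_mul u)
  have hM : ∀ s, (fun s ↦ sSup ((fun u ↦ max (ρ u) 0) '' Icc T s)) s =
      sSup ((fun u ↦ max (ρ u) 0) '' Icc T s) := fun _ ↦ rfl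
  exact ⟨T, _, runMax_mono hM hT0 hT', runMax_nonneg hM,
    fun s hs ↦ (le_max_left _ _).trans (le_runMax hM hT0 hT' hs), tendsto_runMax_div hM hρ hT0 hT'⟩

end RunMax

section Envelope

/-! ### The `ε`-Lipschitz upper envelope `W s = sSup ((fun u ↦ g (s + u) - ε * u) '' Ici 0)` -/

variable {g W : ℝ → ℝ} {ε : ℝ}

/-- Linear-growth bound for a monotone sublinear function: `g v ≤ η * max v 0 + C`. [folklore] -/
private lemma exists_le_mul_max_add (hg : Monotone g)
    (hlim : Tendsto (fun s ↦ g s / s) atTop (𝓝 0)) {η : ℝ} (hη : 0 < η) :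
    ∃ C : ℝ, ∀ v, g v ≤ η * max v 0 + C := by
  obtain ⟨S, -, hS⟩ := exists_forall_le_mul hlim hη
  refine ⟨max (g S) 0, fun v ↦ ?_⟩
  have h0 : 0 ≤ η * max v 0 := mul_nonneg hη.le (le_max_right _ _)
  have h3 : (0 : ℝ) ≤ max (g S) 0 := le_max_right _ _
  rcases le_or_gt v S with h | h
  · have h1 : g v ≤ g S := hg h
    have h2 : g S ≤ max (g S) 0 := le_max_left _ _
    linarith
  · have h1 : g v ≤ η * v := hS v h.le
    have h2 : η * v ≤ η * max v 0 := mul_le_mul_of_nonneg_left (le_max_left _ _) hη.le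
    linarith

/-- Each envelope term is bounded by `η * max s 0 + C` once `g ≤ η * max · 0 + C` with
`0 ≤ η ≤ ε`. [folklore] -/
private lemma term_le {η C : ℝ} (hC : ∀ v, g v ≤ η * max v 0 + C) (hη : 0 ≤ η) (hηε : η ≤ ε)
    (s : ℝ) {u : ℝ} (hu : 0 ≤ u) : g (s + u) - ε * u ≤ η * max s 0 + C := by
  have h1 := hC (s + u)
  have h2 : max (s + u) 0 ≤ max s 0 + u :=
    max_le (add_le_add_left (le_max_left _ _) _) (add_nonneg (le_max_right _ _) hu)
  have h3 : η * max (s + u) 0 ≤ η * (max s 0 + u) := mul_le_mul_of_nonneg_left h2 hη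
  have h4 : η * u ≤ ε * u := mul_le_mul_of_nonneg_right hηε hu
  linarith

/-- The envelope's index image is bounded above. [folklore] -/
private lemma env_bddAbove (hg : Monotone g) (hlim : Tendsto (fun s ↦ g s / s) atTop (𝓝 0))
    (hε : 0 < ε) (s : ℝ) : BddAbove ((fun u ↦ g (s + u) - ε * u) '' Ici 0) := by
  obtain ⟨C, hC⟩ := exists_le_mul_max_add hg hlim hε
  refine ⟨ε * max s 0 + C, ?_⟩
  rintro _ ⟨u, hu, rfl⟩
  exact term_le hC hε.le le_rfl s (mem_Ici.1 hu)

/-- The envelope's index image is nonempty. [folklore] -/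
private lemma env_nonempty (g : ℝ → ℝ) (ε s : ℝ) :
    ((fun u ↦ g (s + u) - ε * u) '' Ici 0).Nonempty :=
  nonempty_Ici.image _

/-- `g s ≤ W s` (the term `u = 0`). [folklore] -/
private lemma le_env (hW : ∀ s, W s = sSup ((fun u ↦ g (s + u) - ε * u) '' Ici 0))
    (hg : Monotone g) (hlim : Tendsto (fun s ↦ g s / s) atTop (𝓝 0)) (hε : 0 < ε) (s : ℝ) :
    g s ≤ W s := by
  rw [hW s]
  refine le_csSup (env_bddAbove hg hlim hε s) ⟨0, self_mem_Ici, ?_⟩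
  simp

/-- The envelope is monotone (each `u`-slice is). [folklore] -/
private lemma env_mono (hW : ∀ s, W s = sSup ((fun u ↦ g (s + u) - ε * u) '' Ici 0))
    (hg : Monotone g) (hlim : Tendsto (fun s ↦ g s / s) atTop (𝓝 0)) (hε : 0 < ε) :
    Monotone W := by
  intro a b hab
  rw [hW a, hW b]
  refine csSup_le (env_nonempty g ε a) ?_
  rintro _ ⟨u, hu, rfl⟩
  have h1 : g (a + u) - ε * u ≤ g (b + u) - ε * u := sub_le_sub_right (hg (by linarith)) _
  exact h1.trans (le_csSup (env_bddAbove hg hlim hε b) ⟨u, hu, rfl⟩)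

/-- One-sided slope bound: `W s' ≤ W s + ε (s' - s)` for `s ≤ s'` (shift the index by `s' - s`).
[folklore] -/
private lemma env_slope (hW : ∀ s, W s = sSup ((fun u ↦ g (s + u) - ε * u) '' Ici 0))
    (hg : Monotone g) (hlim : Tendsto (fun s ↦ g s / s) atTop (𝓝 0)) (hε : 0 < ε) {s s' : ℝ}
    (hss' : s ≤ s') : W s' ≤ W s + ε * (s' - s) := by
  rw [hW s', hW s]
  refine csSup_le (env_nonempty g ε s') ?_
  rintro _ ⟨u, hu, rfl⟩
  have hu' : (0 : ℝ) ≤ s' - s + u := add_nonneg (sub_nonneg.2 hss') (mem_Ici.1 hu)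
  have h : g (s + (s' - s + u)) - ε * (s' - s + u) ≤
      sSup ((fun u ↦ g (s + u) - ε * u) '' Ici 0) :=
    le_csSup (env_bddAbove hg hlim hε s) ⟨s' - s + u, mem_Ici.2 hu', rfl⟩
  have he : s + (s' - s + u) = s' + u := by ring
  rw [he] at h
  change g (s' + u) - ε * u ≤ _
  linarith

/-- The envelope is `ε`-Lipschitz (monotone with slope `≤ ε`), hence continuous. [folklore] -/
private lemma env_continuous (hW : ∀ s, W s = sSup ((fun u ↦ g (s + u) - ε * u) '' Ici 0))
    (hg : Monotone g) (hlim : Tendsto (fun s ↦ g s / s) atTop (𝓝 0)) (hε : 0 < ε) :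
    Continuous W := by
  refine (LipschitzWith.of_le_add_mul' ε fun x y ↦ ?_).continuous
  rcases le_total x y with h | h
  · exact (env_mono hW hg hlim hε h).trans (le_add_of_nonneg_right (by positivity))
  · rw [Real.dist_eq, abs_of_nonneg (sub_nonneg.2 h)]
    exact env_slope hW hg hlim hε h

/-- Linear-growth bound for the envelope. [folklore] -/
private lemma env_le (hW : ∀ s, W s = sSup ((fun u ↦ g (s + u) - ε * u) '' Ici 0)) {η C : ℝ}
    (hC : ∀ v, g v ≤ η * max v 0 + C) (hη : 0 ≤ η) (hηε : η ≤ ε) (s : ℝ) :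
    W s ≤ η * max s 0 + C := by
  rw [hW s]
  refine csSup_le (env_nonempty g ε s) ?_
  rintro _ ⟨u, hu, rfl⟩
  exact term_le hC hη hηε s (mem_Ici.1 hu)

/-- The envelope is sublinear: `W s / s → 0`. [folklore] -/
private lemma tendsto_env_div (hW : ∀ s, W s = sSup ((fun u ↦ g (s + u) - ε * u) '' Ici 0))
    (hg : Monotone g) (hlim : Tendsto (fun s ↦ g s / s) atTop (𝓝 0)) (hε : 0 < ε) :
    Tendsto (fun s ↦ W s / s) atTop (𝓝 0) := by
  rw [tendsto_order]
  refine ⟨fun a ha ↦ ?_, fun b hb ↦ ?_⟩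
  · filter_upwards [hlim.eventually_const_lt ha, eventually_gt_atTop 0] with s hs1 hs2
    exact hs1.trans_le (div_le_div_of_nonneg_right (le_env hW hg hlim hε s) hs2.le)
  · have hη : 0 < min (b / 2) ε := lt_min (half_pos hb) hε
    obtain ⟨C, hC⟩ := exists_le_mul_max_add hg hlim hη
    have hlimC : Tendsto (fun s : ℝ ↦ C / s) atTop (𝓝 0) :=
      tendsto_const_nhds.div_atTop tendsto_id
    filter_upwards [eventually_gt_atTop 0, hlimC.eventually_lt_const (half_pos hb)]
      with s hs1 hs2
    have hle : W s ≤ min (b / 2) ε * s + C := by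
      have h := env_le hW hC hη.le (min_le_right _ _) s
      rwa [max_eq_left hs1.le] at h
    calc W s / s ≤ (min (b / 2) ε * s + C) / s := div_le_div_of_nonneg_right hle hs1.le
      _ = min (b / 2) ε + C / s := by rw [add_div, mul_div_assoc, div_self hs1.ne', mul_one]
      _ < b := by linarith [min_le_left (b / 2) ε]

/-- A monotone sublinear `g` admits, for every `ε > 0`, a continuous, monotone, sublinear majorant
of one-sided slope `≤ ε` (its `ε`-Lipschitz upper envelope). [folklore] -/
private lemma exists_envelope (hg : Monotone g) (hlim : Tendsto (fun s ↦ g s / s) atTop (𝓝 0))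
    (hε : 0 < ε) :
    ∃ W : ℝ → ℝ, Continuous W ∧ Monotone W ∧ Tendsto (fun s ↦ W s / s) atTop (𝓝 0) ∧
      (∀ s s', s ≤ s' → W s' ≤ W s + ε * (s' - s)) ∧ ∀ s, g s ≤ W s := by
  have hW : ∀ s, (fun s ↦ sSup ((fun u ↦ g (s + u) - ε * u) '' Ici 0)) s =
      sSup ((fun u ↦ g (s + u) - ε * u) '' Ici 0) := fun _ ↦ rfl
  exact ⟨_, env_continuous hW hg hlim hε, env_mono hW hg hlim hε, tendsto_env_div hW hg hlim hε,
    fun _ _ h ↦ env_slope hW hg hlim hε h, le_env hW hg hlim hε⟩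

end Envelope

/-- **S1 — normalised wall majorant, proved**: `W` is the `ε`-Lipschitz upper envelope
`sup_{u ≥ 0} (g (s + u) - ε u)` of `g := 3 M + 2 + |R|`, `M` the running supremum of `max ρ 0`
over `[T₀, s]` (where `ρ u ≤ u` on `[T₀, ∞)`); `W` is monotone with slope `≤ ε` (so continuous),
`≥ g ≥ R`, `≥ 3 ρ + 2` on `[T₀, ∞)`, and sublinear since `M` is. [folklore] -/
theorem stub_wallMajorant : Literature.Uncategorized.WallMajorant := by
  intro ρ hρ ε R hε
  obtain ⟨T, M, hmono, h0, hmaj, hlim⟩ := exists_monotone_majorant hρ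
  have hg : Monotone fun s ↦ 3 * M s + 2 + |R| := by
    intro a b hab
    have h := hmono hab
    change 3 * M a + 2 + |R| ≤ 3 * M b + 2 + |R|
    linarith
  have hglim : Tendsto (fun s ↦ (3 * M s + 2 + |R|) / s) atTop (𝓝 0) := by
    have h2 : Tendsto (fun s : ℝ ↦ (2 + |R|) / s) atTop (𝓝 0) :=
      tendsto_const_nhds.div_atTop tendsto_id
    have h := (hlim.const_mul 3).add h2
    rw [mul_zero, add_zero] at h
    exact h.congr fun s ↦ by ring
  obtain ⟨W, hWc, hWm, hWl, hWs, hgW⟩ := exists_envelope hg hglim hε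
  refine ⟨T, W, hWc, hWm, hWl, hWs, fun s ↦ ?_, fun s hs ↦ ?_⟩
  · have h1 : 3 * M s + 2 + |R| ≤ W s := hgW s
    have h2 := h0 s
    have h3 := le_abs_self R
    linarith
  · have h1 : 3 * M s + 2 + |R| ≤ W s := hgW s
    have h2 := hmaj s hs
    have h3 := abs_nonneg R
    linarith

end Summit.FinalStateConjecture.FinalStateConjecture.Theorems.NeckGapDecay.ConnectionLevelCones.WallMajorantStub
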